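import Literature.MathematicalPhysics.QuantumFieldTheory.Balaban1983to89.B12NodeKnitRecord10
import Literature.MathematicalPhysics.QuantumFieldTheory.Balaban1983to89.Node00.Record11

/-!
# NODE N09 · [Balaban1987RG1] AT THE STAGE-11 RECORD `Node00.IsRecordOfRecord₁₁C` — the Theorem-3 member FROM [B11] THEOREM 1 AT THE RECORD'S OBJECTS AND THE
# RECORD'S OWN PROVISO, re-keyed at def-T's §2 [III] format pin: the ₁₁ twin of `B12NodeKnitRecord10`

T. Bałaban, *Renormalization group approach to lattice gauge field theories. I*, Commun. Math. Phys. **109** (1987) 249–301 [Balaban1987RG1] (= [I]);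
[Balaban1985Variational] (= [B11]) Thm 1 p. 279.  TRACK A (YM-PLAN §2b, node N09 of 28), seat `pub-ymgap-dag-n09-d` (prover, KNIT-BY-NAME AT ₁₁C, strategy s2;
HUMAN RULING D-0062, director-ym R134), MODULE 3′.  THEOREMS ONLY, def-free, sorry-free, standard axioms.

THE STAGE-11 RECORD (`Node00.Record11`, node00-def-T, DEDUP №11 tranche 11d): the Stage-10 record OVER NEW PARAMETERS `Stage11Params ⊇ Stage9Params` with the two
§2 [III] FORMAT PINS (`S218OfRecord₁₁`, `ScorrLawOfRecord₁₁`) — the core of record is `coreOfRecord₁₁ θ = {coreOfRecord₁₀ θ.toStage9Params with Sect2Form := …}`,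
so THE ACTION SIDE N09 READS IS STAGE 10's VERBATIM at the Stage-9 part (`actionSide_stage11`, `rfl` ∕ `Iff.rfl`): the construction's flow is
`genFlow (betaOfRecord₁₀ θ.toStage9Params) p.g₀` (`T4DatumAssembly.flow_datumOfTower`, `rfl`), its inductive-assumption clause is node00-def-B's transport-generic
`IndAOfRecordT (TcOfRecord) (chiFixed7 θ.ν) θ.εbg (betaOfRecord₁₀ θ.toStage9Params) …` at the generated history `gOfRecord₁₀ θ.toStage9Params p` and the record's
objects (`Iff.rfl`), and the displayed provisos `Provisos₁₁` CARRY `base : Provisos₁₀` of the Stage-9 part, hence the β-version proviso `contT`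
(`Provisos₁₁.hasContTransportAlong`).  The §2 pins concern the 𝐑-leaf and the core's `Sect2Form` clause (N11 ∕ N13's junction), NOT N09's member.

WHAT THIS FILE PROVES — the binder census of N09 at ₁₁ IS THE ₁₀ CENSUS, re-keyed (nothing new is displayed, nothing displayed at ₁₀ drops):
* §1 θ-EXPLICIT (world bound to `(datumOfRecord₁₁ θ h).C`, `θ : Stage11Params`, `h : θ.Provisos₁₁`): `indAss_stage11_of_hRestrict` (`IndAss k`, `k ≤ K`, from the
  flow recursion up to `k`, (1.1) at level `k` on `domAltOfRecord F N θ.ν`, `HRestrict`, intermediate uniqueness — NOTHING ELSE; the composition input is MODULE 2's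
  `B12NodeKnitContinuousTransport.indAOfRecordT_atRecord_TcOfRecord` fed by `h.base.contT`), `indAss_stage11_zero` (first step, window `θ.ν.ε₀ ≤ θ.εbg` — Stage 10's
  `indAss_stage10_zero` read through `actionSide_stage11`), **`thm3Member_stage11_of_hRestrict`** (the Theorem-3 member `smallCouplings → smallFieldInductive` from
  (1.1) + `HRestrict` + intermediate uniqueness, via MODULE 2's `thm3Member_of_indATPlug_TcOfRecord` at the (F) ∕ (I) faces of the Stage-11 construction, proviso
  `h.base.contT`), `b12_main_stage11_of_leaf_of_hRestrict`, `b12_main_stage11_iff_leaf_of_hRestrict` (N09 ⇔ «b4 → … → b11 → b12»).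
* §2 AT `IsRecordOfRecord₁₁C F N D w`: **`thm3Member_at_record₁₁C_of_hRestrict`** (binders over the presenting Stage-11 parameters AND their provisos: (1.1) on
  the domains, `HRestrict`, intermediate uniqueness), **`b12_main_at_record₁₁C_iff_leaf`**, `b12_leaf_at_record₁₁C_iff` (the own leaf unfolded:
  `Lemma4Printed (θ.res.X P).F12 (θ.res.X P).c12` over the FREE residual B12 carriers — `residualOfStage11` pins `V` and `S218` only; conjunct 1's B12-group pin
  `Node00/CarriersB12` NODE 00 still owes), **`b12_main_at_record₁₁C_of_leaf`** (N09 at every run of a Stage-11 record from the B12-group pin slot + [B11] Thm 1 at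
  the record's objects — the `h09`-binder shape for N24's knit at ₁₁C, cf. `Node00/N24KnitStage10C`'s use of `B12NodeKnitRecord10.b12_main_at_record₁₀C_of_leaf`).
CENSUS OF N09 AT ₁₁ (kernel): member ⇐ (c) [B11] Thm 1 at the record's level domains ((1.1) existence + uniqueness on `domAltOfRecord`, `HRestrict`, uniqueness at
the averaged minimisers) — N07's content at the record — and the record's own provisos (`contT` via `base`); (d) composition ∕ invariance clauses: NONE displayed
(theorems, MODULES 1–2); conjunct 1 = the B12-group pin over the free `Residual₅.X` (unchanged since ₅C).
HONEST FRAMING: count-neutral kernel bookkeeping; N09 NOT discharged (conjunct 1's pin and N07's inputs are binders; `IsRecordOfRecord₁₁C` not yet known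
inhabited — K0 `Record11Inhabited`, stmt-QuantumFields-19673); nothing of Bałaban's asserted; one finite four-torus programme at fixed ε — NOT ℝ⁴, NOT infinite
volume, NOT OS axioms, NOT a mass gap, NOT Clay.  Filed `--supports` K1 `StabilityBAtRecordR11e` (stmt-QuantumFields-19674).
-/

noncomputable section

namespace Literature.MathematicalPhysics.QuantumFieldTheory.Balaban1983to89.B12NodeKnitRecord11

open DagBinding Node00 T4Continuum
open FlowStep (HBeta prefixOf RGEqH)
open FlowStepRuns (genSeq genFlow)
open B12NodeKnitRecord8 (b12_main_of_leaf_of_thm3Member b12_main_iff_leaf_of_thm3Member)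
open B12NodeKnitContinuousTransport (indAOfRecordT_atRecord_TcOfRecord thm3Member_of_indATPlug_TcOfRecord)

variable (F : T4Family) (N : ℕ) [NeZero N]

/-! ## §0. The two faces of the Stage-11 construction N09 reads (Stage 10's, at the Stage-9 part; `rfl` ∕ `Iff.rfl`) -/

/-- FACE flow AT STAGE 11: every run's flow is generated FORWARD by (0.20) with the β of record of the Stage-9 part — `genFlow (betaOfRecord₁₀ θ.toStage9Params) p.g₀`
(`T4DatumAssembly.flow_datumOfTower` at `coreOfRecord₁₁ θ`, whose `βfun` is Stage 10's; `rfl`). [cite: Balaban1987RG1, (0.17)–(0.20) pp.255–256 (bookkeeping)] -/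
theorem flow_stage11 (θ : Stage11Params F N) (h : θ.Provisos₁₁) (p : B12.RunParams) :
    ((datumOfRecord₁₁ F N θ h).C p).flow = genFlow (betaOfRecord₁₀ F N θ.toStage9Params) p.g0 := rfl

/-- FACE `IndAss` AT STAGE 11: the clause IS def-B's transport-generic `IndAOfRecordT (TcOfRecord) (chiFixed7 θ.ν) …` read at the generated history and the record's
objects of the Stage-9 part — Stage 10's reading VERBATIM (`Iff.rfl`; def-T's `actionSide_stage11` composed with `indAss_stage10_iff`).
[cite: Balaban1987RG1, (1.1)–(1.6) pp.260–261 and Thm 3 p.264 (bookkeeping)] -/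
theorem indAss_stage11_iff (θ : Stage11Params F N) (h : θ.Provisos₁₁) (p : B12.RunParams) (k : ℕ) :
    ((datumOfRecord₁₁ F N θ h).C p).IndAss k ↔
      IndAOfRecordT F N (TcOfRecord F N) (chiFixed7 F N θ.ν) θ.εbg (betaOfRecord₁₀ F N θ.toStage9Params) p k
        (prefixOf (gOfRecord₁₀ F N θ.toStage9Params p) k) (domAltOfRecord F N θ.ν p.K k)
        (effActionOfRecordT F N (TcOfRecord F N) (chiFixed7 F N θ.ν) (betaOfRecord₁₀ F N θ.toStage9Params) p k) (wilsonBGOfRecord F N θ.εbg p k)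
        (EkOfRecordT F N (TcOfRecord F N) (chiFixed7 F N θ.ν) θ.εbg (betaOfRecord₁₀ F N θ.toStage9Params) p k) := Iff.rfl

/-! ## §1. θ-explicit: a world bound to the Stage-11 construction `(datumOfRecord₁₁ θ h).C` -/

/-- **`IndAss k` AT THE STAGE-11 CONSTRUCTION FROM [B11] THM 1 AT THE RECORD'S OBJECTS ALONE** (`k ≤ K`): the flow recursion up to `k`, (1.1) at level `k` on
`domAltOfRecord`, `HRestrict` and (1.1)-uniqueness at the intermediate levels — the composition input is MODULE 2's theorem fed by the record's own proviso
`h.base.contT`.  NO composition, invariance or χ-locality hypothesis (the ₁₀ proof, re-keyed). [cite: Balaban1987RG1, (1.1)–(1.3) p.260, (0.22)–(0.23) p.256, p.263 and (2.16) p.269; Balaban1985Variational, Thm 1 (8)–(10) p.279] -/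
theorem indAss_stage11_of_hRestrict (θ : Stage11Params F N) (h : θ.Provisos₁₁) (p : B12.RunParams) (k : ℕ) (hk : k ≤ p.K)
    (hflow : RGEqH k (betaOfRecord₁₀ F N θ.toStage9Params) (gOfRecord₁₀ F N θ.toStage9Params p))
    (h11 : ∀ V ∈ domAltOfRecord F N θ.ν p.K k, UkExists F N p.K k θ.εbg V ∧ UniqueUkOrbit F N p.K k θ.εbg V)
    (hres : HRestrict F N θ.εbg p.K k (domAltOfRecord F N θ.ν p.K k))
    (huniq : ∀ V ∈ domAltOfRecord F N θ.ν p.K k, ∀ j < k,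
      UniqueUkOrbit F N p.K (j + 1) θ.εbg (Averaging.iter (avOfRecord F N p.K) (j + 1) (Uk F N p.K k θ.εbg V))) :
    ((datumOfRecord₁₁ F N θ h).C p).IndAss k :=
  (indAss_stage11_iff F N θ h p k).2
    (indAOfRecordT_atRecord_TcOfRecord θ.ν θ.εbg (betaOfRecord₁₀ F N θ.toStage9Params) p k hk (domAltOfRecord F N θ.ν p.K k)
      (fun j hj => h.base.contT p.K (gOfRecord₁₀ F N θ.toStage9Params p) j (hj.trans_le hk)) hflow h11 hres huniq)

/-- **THE FIRST STEP AT THE STAGE-11 CONSTRUCTION** modulo the numeric window `θ.ν.ε₀ ≤ θ.εbg` — Stage 10's `indAss_stage10_zero` at the Stage-9 part, read through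
the `IndAss` face (both sides ARE def-B's clause at level `0`). [cite: Balaban1987RG1, (0.17) p.255 and (1.1)–(1.3) p.260] -/
theorem indAss_stage11_zero (θ : Stage11Params F N) (h : θ.Provisos₁₁) (hε : θ.ν.ε₀ ≤ θ.εbg) (p : B12.RunParams) :
    ((datumOfRecord₁₁ F N θ h).C p).IndAss 0 :=
  (indAss_stage11_iff F N θ h p 0).2
    ((indAss_stage10_iff F N θ.toStage9Params h.base p 0).1 (B12NodeKnitRecord10.indAss_stage10_zero F N θ.toStage9Params h.base hε p))

section Stage11

variable {F N}

/-- **THE THEOREM-3 MEMBER OF N09 AT `(w, P)` FOR A WORLD BOUND TO THE STAGE-11 CONSTRUCTION, FROM [B11] THM 1 AT THE RECORD'S OBJECTS ALONE**: (1.1) on the level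
domains `domAltOfRecord F N θ.ν`, `HRestrict` ([B11] Thm 1 (8)–(10): the global minimiser restricts) and (1.1)-uniqueness at the intermediate levels give
`smallCouplings → smallFieldInductive` — MODULE 2's `thm3Member_of_indATPlug_TcOfRecord` at (F) `flow_stage11`, (I) `indAss_stage11_iff`, with the per-step
continuity proviso supplied by the record itself (`h.base.contT`).  The ₁₀ theorem `B12NodeKnitRecord10.thm3Member_stage10_of_hRestrict`, re-keyed: same binders.
[cite: Balaban1987RG1, Thm 3 p.264, (1.1)–(1.3) p.260, (0.21)–(0.23) p.256, p.263 and (2.16) p.269; Balaban1985Variational, Thm 1 (8)–(10) p.279] -/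
theorem thm3Member_stage11_of_hRestrict (θ : Stage11Params F N) (h : θ.Provisos₁₁) {w : WorldP}
    (hC : w.C = (datumOfRecord₁₁ F N θ h).C) (P : B12.RunParams)
    (h11 : ∀ k, k ≤ P.K → ∀ V ∈ domAltOfRecord F N θ.ν P.K k, UkExists F N P.K k θ.εbg V ∧ UniqueUkOrbit F N P.K k θ.εbg V)
    (hres : ∀ k, k ≤ P.K → HRestrict F N θ.εbg P.K k (domAltOfRecord F N θ.ν P.K k))
    (huniq : ∀ k, k ≤ P.K → ∀ V ∈ domAltOfRecord F N θ.ν P.K k, ∀ j < k,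
      UniqueUkOrbit F N P.K (j + 1) θ.εbg (Averaging.iter (avOfRecord F N P.K) (j + 1) (Uk F N P.K k θ.εbg V))) :
    (leavesP w P).smallCouplings → (leavesP w P).smallFieldInductive :=
  thm3Member_of_indATPlug_TcOfRecord θ.ν θ.εbg (betaOfRecord₁₀ F N θ.toStage9Params) (fun k => domAltOfRecord F N θ.ν P.K k)
    (by rw [hC]; exact flow_stage11 F N θ h P) (fun k _ => by rw [hC]; exact indAss_stage11_iff F N θ h P k)
    (fun k hk => h.base.contT P.K (gOfRecord₁₀ F N θ.toStage9Params P) k hk) h11 hres huniq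

/-- **N09 AT `(w, P)`, Stage-11 construction, from the own leaf and [B11] Thm 1 at the record's objects.** [cite: Balaban1987RG1, Lemma 4 (3.53) p.280, Thm 3 p.264 and (1.1)–(1.3) p.260; Balaban1985Variational, Thm 1 p.279] -/
theorem b12_main_stage11_of_leaf_of_hRestrict (θ : Stage11Params F N) (h : θ.Provisos₁₁) {w : WorldP}
    (hC : w.C = (datumOfRecord₁₁ F N θ h).C) (P : B12.RunParams) (h12 : (leavesP w P).b12)
    (h11 : ∀ k, k ≤ P.K → ∀ V ∈ domAltOfRecord F N θ.ν P.K k, UkExists F N P.K k θ.εbg V ∧ UniqueUkOrbit F N P.K k θ.εbg V)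
    (hres : ∀ k, k ≤ P.K → HRestrict F N θ.εbg P.K k (domAltOfRecord F N θ.ν P.K k))
    (huniq : ∀ k, k ≤ P.K → ∀ V ∈ domAltOfRecord F N θ.ν P.K k, ∀ j < k,
      UniqueUkOrbit F N P.K (j + 1) θ.εbg (Averaging.iter (avOfRecord F N P.K) (j + 1) (Uk F N P.K k θ.εbg V))) :
    Dag.B12_main (leavesP w P) :=
  b12_main_of_leaf_of_thm3Member h12 (thm3Member_stage11_of_hRestrict θ h hC P h11 hres huniq)

/-- **N09 AT `(w, P)`, Stage-11 construction, IS «in-edges → its own leaf `b12`»** given [B11] Thm 1 at the record's objects. [cite: Balaban1987RG1, Lemma 4 (3.53) p.280 and Thm 3 p.264] -/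
theorem b12_main_stage11_iff_leaf_of_hRestrict (θ : Stage11Params F N) (h : θ.Provisos₁₁) {w : WorldP}
    (hC : w.C = (datumOfRecord₁₁ F N θ h).C) (P : B12.RunParams)
    (h11 : ∀ k, k ≤ P.K → ∀ V ∈ domAltOfRecord F N θ.ν P.K k, UkExists F N P.K k θ.εbg V ∧ UniqueUkOrbit F N P.K k θ.εbg V)
    (hres : ∀ k, k ≤ P.K → HRestrict F N θ.εbg P.K k (domAltOfRecord F N θ.ν P.K k))
    (huniq : ∀ k, k ≤ P.K → ∀ V ∈ domAltOfRecord F N θ.ν P.K k, ∀ j < k,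
      UniqueUkOrbit F N P.K (j + 1) θ.εbg (Averaging.iter (avOfRecord F N P.K) (j + 1) (Uk F N P.K k θ.εbg V))) :
    Dag.B12_main (leavesP w P) ↔
      ((leavesP w P).b4 → (leavesP w P).b5 → (leavesP w P).b6 → (leavesP w P).b7 → (leavesP w P).b8 → (leavesP w P).b9 →
        (leavesP w P).b10 → (leavesP w P).b11 → (leavesP w P).b12) :=
  b12_main_iff_leaf_of_thm3Member (thm3Member_stage11_of_hRestrict θ h hC P h11 hres huniq)

end Stage11

/-! ## §2. At the Stage-11 record predicate `IsRecordOfRecord₁₁C F N D w` (binders over the presenting parameters and their provisos) -/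

section Record

variable {F N}
variable {D : FiniteEpsData F (SU N)} {w : WorldP}

/-- **THE THEOREM-3 MEMBER OF N09 AT EVERY RUN OF A STAGE-11 RECORD, FROM [B11] THM 1 AT THE RECORD'S OBJECTS** over the presenting parameters: (1.1) on the
domains, `HRestrict`, intermediate uniqueness — no composition ∕ invariance binder (the record's `base.contT` feeds MODULE 2's theorem).
[cite: Balaban1987RG1, Thm 1 p.259, Thm 3 p.264, (1.1)–(1.3) p.260 and (2.16) p.269; Balaban1985Variational, Thm 1 (8)–(10) p.279] -/
theorem thm3Member_at_record₁₁C_of_hRestrict (hrec : IsRecordOfRecord₁₁C F N D w)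
    (h11 : ∀ θ : Stage11Params F N, ∀ h : θ.Provisos₁₁, θ.Admissible → D = datumOfRecord₁₁ F N θ h → w.γ ≤ θ.γ →
      ∀ (p : B12.RunParams) (k : ℕ), k ≤ p.K →
        ∀ V ∈ domAltOfRecord F N θ.ν p.K k, UkExists F N p.K k θ.εbg V ∧ UniqueUkOrbit F N p.K k θ.εbg V)
    (hres : ∀ θ : Stage11Params F N, ∀ h : θ.Provisos₁₁, θ.Admissible → D = datumOfRecord₁₁ F N θ h → w.γ ≤ θ.γ →
      ∀ (p : B12.RunParams) (k : ℕ), k ≤ p.K → HRestrict F N θ.εbg p.K k (domAltOfRecord F N θ.ν p.K k))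
    (huniq : ∀ θ : Stage11Params F N, ∀ h : θ.Provisos₁₁, θ.Admissible → D = datumOfRecord₁₁ F N θ h → w.γ ≤ θ.γ →
      ∀ (p : B12.RunParams) (k : ℕ), k ≤ p.K → ∀ V ∈ domAltOfRecord F N θ.ν p.K k, ∀ j < k,
        UniqueUkOrbit F N p.K (j + 1) θ.εbg (Averaging.iter (avOfRecord F N p.K) (j + 1) (Uk F N p.K k θ.εbg V)))
    (P : B12.RunParams) : (leavesP w P).smallCouplings → (leavesP w P).smallFieldInductive := by
  obtain ⟨θ, h, hθ, hD, hC, hγ, -, -⟩ := hrec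
  have hC' : w.C = (datumOfRecord₁₁ F N θ h).C := by rw [hC, hD]
  exact thm3Member_stage11_of_hRestrict θ h hC' P (fun k hk => h11 θ h hθ hD hγ.2 P k hk) (fun k hk => hres θ h hθ hD hγ.2 P k hk)
    (fun k hk => huniq θ h hθ hD hγ.2 P k hk)

/-- **N09 AT A STAGE-11 RECORD IS ITS OWN LEAF** (given [B11] Thm 1 at the record's objects over the presenting parameters): `Dag.B12_main (leavesP w P)` ↔ «`b4 → … →
b11 → b12`». [cite: Balaban1987RG1, Lemma 4 (3.53) p.280, Thm 1 p.259 and Thm 3 p.264] -/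
theorem b12_main_at_record₁₁C_iff_leaf (hrec : IsRecordOfRecord₁₁C F N D w)
    (h11 : ∀ θ : Stage11Params F N, ∀ h : θ.Provisos₁₁, θ.Admissible → D = datumOfRecord₁₁ F N θ h → w.γ ≤ θ.γ →
      ∀ (p : B12.RunParams) (k : ℕ), k ≤ p.K →
        ∀ V ∈ domAltOfRecord F N θ.ν p.K k, UkExists F N p.K k θ.εbg V ∧ UniqueUkOrbit F N p.K k θ.εbg V)
    (hres : ∀ θ : Stage11Params F N, ∀ h : θ.Provisos₁₁, θ.Admissible → D = datumOfRecord₁₁ F N θ h → w.γ ≤ θ.γ →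
      ∀ (p : B12.RunParams) (k : ℕ), k ≤ p.K → HRestrict F N θ.εbg p.K k (domAltOfRecord F N θ.ν p.K k))
    (huniq : ∀ θ : Stage11Params F N, ∀ h : θ.Provisos₁₁, θ.Admissible → D = datumOfRecord₁₁ F N θ h → w.γ ≤ θ.γ →
      ∀ (p : B12.RunParams) (k : ℕ), k ≤ p.K → ∀ V ∈ domAltOfRecord F N θ.ν p.K k, ∀ j < k,
        UniqueUkOrbit F N p.K (j + 1) θ.εbg (Averaging.iter (avOfRecord F N p.K) (j + 1) (Uk F N p.K k θ.εbg V)))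
    (P : B12.RunParams) :
    Dag.B12_main (leavesP w P) ↔
      ((leavesP w P).b4 → (leavesP w P).b5 → (leavesP w P).b6 → (leavesP w P).b7 → (leavesP w P).b8 → (leavesP w P).b9 →
        (leavesP w P).b10 → (leavesP w P).b11 → (leavesP w P).b12) :=
  b12_main_iff_leaf_of_thm3Member (thm3Member_at_record₁₁C_of_hRestrict hrec h11 hres huniq P)

/-- **THE OWN LEAF AT A STAGE-11 RECORD, UNFOLDED** over the presenting parameters: `(leavesP w P).b12 ↔ B12Sec2to5.Lemma4Printed (θ.res.X P).F12 (θ.res.X P).c12` —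
Lemma 4 over the record's FREE run-indexed B12 carriers (the B12-group pin NODE 00 owes; `residualOfStage11` pins `V` and `S218` and keeps `X` free).
[cite: Balaban1987RG1, Lemma 4 (3.53) p.280 (bookkeeping)] -/
theorem b12_leaf_at_record₁₁C_iff (hrec : IsRecordOfRecord₁₁C F N D w) (P : B12.RunParams) :
    ∃ (θ : Stage11Params F N) (h : θ.Provisos₁₁), θ.Admissible ∧ D = datumOfRecord₁₁ F N θ h ∧
      (∀ P', w.up P' = upOfRecord₅C F N (θ.toStage5₁₁ F N) P') ∧
        ((leavesP w P).b12 ↔ B12Sec2to5.Lemma4Printed (θ.res.X P).F12 (θ.res.X P).c12) := by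
  obtain ⟨θ, h, hθ, hD, -, -, -, hup⟩ := hrec
  refine ⟨θ, h, hθ, hD, hup, ?_⟩
  show (w.up P).b12 ↔ _
  rw [hup P]
  exact Iff.rfl

/-- **N09 AT EVERY RUN OF A STAGE-11 RECORD from the B12-group pin slot + [B11] Thm 1 at the record's objects over the presenting parameters** — the `h09`-binder
shape for N24's knit at ₁₁C (the ₁₀ theorem `B12NodeKnitRecord10.b12_main_at_record₁₀C_of_leaf`, re-keyed: same four binders). [cite: Balaban1987RG1, Lemma 4 (3.53) p.280, Thm 1 p.259 and Thm 3 p.264; Balaban1985Variational, Thm 1 p.279] -/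
theorem b12_main_at_record₁₁C_of_leaf (hrec : IsRecordOfRecord₁₁C F N D w)
    (hb12 : ∀ θ : Stage11Params F N, ∀ h : θ.Provisos₁₁, θ.Admissible → D = datumOfRecord₁₁ F N θ h → w.γ ≤ θ.γ →
      (∀ P, w.up P = upOfRecord₅C F N (θ.toStage5₁₁ F N) P) → ∀ P, B12Sec2to5.Lemma4Printed (θ.res.X P).F12 (θ.res.X P).c12)
    (h11 : ∀ θ : Stage11Params F N, ∀ h : θ.Provisos₁₁, θ.Admissible → D = datumOfRecord₁₁ F N θ h → w.γ ≤ θ.γ →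
      ∀ (p : B12.RunParams) (k : ℕ), k ≤ p.K →
        ∀ V ∈ domAltOfRecord F N θ.ν p.K k, UkExists F N p.K k θ.εbg V ∧ UniqueUkOrbit F N p.K k θ.εbg V)
    (hres : ∀ θ : Stage11Params F N, ∀ h : θ.Provisos₁₁, θ.Admissible → D = datumOfRecord₁₁ F N θ h → w.γ ≤ θ.γ →
      ∀ (p : B12.RunParams) (k : ℕ), k ≤ p.K → HRestrict F N θ.εbg p.K k (domAltOfRecord F N θ.ν p.K k))
    (huniq : ∀ θ : Stage11Params F N, ∀ h : θ.Provisos₁₁, θ.Admissible → D = datumOfRecord₁₁ F N θ h → w.γ ≤ θ.γ →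
      ∀ (p : B12.RunParams) (k : ℕ), k ≤ p.K → ∀ V ∈ domAltOfRecord F N θ.ν p.K k, ∀ j < k,
        UniqueUkOrbit F N p.K (j + 1) θ.εbg (Averaging.iter (avOfRecord F N p.K) (j + 1) (Uk F N p.K k θ.εbg V)))
    (P : B12.RunParams) : Dag.B12_main (leavesP w P) := by
  obtain ⟨θ, h, hθ, hD, hC, hγ, -, hup⟩ := id hrec
  have h12 : (leavesP w P).b12 := by
    show (w.up P).b12
    rw [hup P]
    exact hb12 θ h hθ hD hγ.2 hup P
  exact b12_main_of_leaf_of_thm3Member h12 (thm3Member_at_record₁₁C_of_hRestrict hrec h11 hres huniq P)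

end Record

end Literature.MathematicalPhysics.QuantumFieldTheory.Balaban1983to89.B12NodeKnitRecord11

end
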